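import Literature.MathematicalPhysics.QuantumFieldTheory.Balaban1983to89.B6SectAVectorModelV1

/-!
# `Balaban1983to89.B6SectAUnitsHomogeneityV1` — T. Bałaban, *Propagators and renormalization transformations for lattice gauge theories. II*,
# Commun. Math. Phys. **96** (1984) 223–250 [Balaban1984PropagatorsII], Sect. A (2.8) p. 224, (2.12) p. 225, (2.19)∕(2.22) p. 226: THE OPERATORS OF
# SECT. A ARE HOMOGENEOUS IN THE LATTICE FACTOR — `∂, ∂*` of degree 1, the projection `R` of degree 0, `Δ_a(c, w)` of degree 2 and `G = Δ_a⁻¹` of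
# degree −2 when the averaging weights scale with the square (units bookkeeping at FIXED nominal data `D`)

statement-level skeleton of published theorems with citation tags; proofs where landed; nothing here is a claim about the Yang–Mills mass gap

CITATION HEADER (lean-in-tree rule) — WHAT IS REPRODUCED.  Cell `pub-ymgap`, seat `pub-ymgap-dag-n03-b` (g2), for the located caveat (c7) of the chair's
★★★ R443 on row N03 as re-worded by dag-p1's `Node00.N03IndexOddL` (p416350) HONEST SCOPE (2): «in `KRIdx` (`c_f = Lᵏ` pinned) the re-indexed copy carries
`c_f = L·c_f′`, `w = L²·w′` (same relative weights)».  THIS FILE supplies the kernel facts behind that sentence AT FIXED NOMINAL DATA (one `Domains P` datum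
`D`, two lattice factors): print's letters of Sect. A, as typed in r03's `…B6SectAOperatorsV1` ∕ `…B6SectAVectorModelV1`, scale as their dimensions say —
* §1 `lapE_mul` (`Δ(s·c) = s²·Δ(c)`), `KE_mul` (`Δ(s·c)N(Q′) = Δ(c)N(Q′)`, Mathlib `Submodule.map_smul`), **`RE_mul`** (`R(s·c) = R(c)`: the orthogonal
  projection onto `ΔN(Q′)` (2.12) does not see the lattice factor);
* §2 `gradFn_mul`, `divFn_mul`, `curlFn_mul`, `onE_smul`, hence `dE_mul`, `dsE_mul`, `dcE_mul`, `dcsE_mul` (degree 1; `∂*` on plaquette fields through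
  `map_smulₛₗ LinearMap.adjoint`), and `aE_smul` (the averaging letter is linear in the weights);
* §3 **`deltaAE_mul`**: `Δ_a(s·c, s²·w) = s²·Δ_a(c, w)` for (2.19) `Δ_a = ∂*∂ + ∂R∂* + Q*aQ`, and **`GE_mul`**: `G(s·c, s²·w) = s⁻²·G(c, w)` for (2.22)
  `G = Δ_a⁻¹` (from r03's `deltaAE_GE` ∕ `GE_deltaAE`).
With `s = L`: the re-indexed member of `N03IndexOddL` HONEST SCOPE (2) has `Δ_a ↦ L²·Δ_a`, `G ↦ L⁻²·G`; the weight band (2.16) is invariant because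
`w∕(c_f∕Lⁿ)²` is.  THEOREMS ONLY (no `def`, no `def … : Prop`); standard axioms.

HONEST SCOPE.  (1) SAME-TYPE statements only: both sides live on ONE nominal datum `D` (the cross-type identification of a nominal-`k` top-empty member
with a genuine `(k−1)`-level family — `BondIdx D` is indexed by the nominal `k` — is dag-p1's HONEST SCOPE (3), untouched here).  (2) Units bookkeeping,
no inequality of print; integer torus ∕ any `Params`; nothing on d = 4 or the continuum; NOT a discharge; NOT summit progress.  Unit `pub-ymgap-dag-n03-b`
(gen 2), 2026-08-26.
-/

open scoped InnerProductSpace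

namespace Literature.MathematicalPhysics.QuantumFieldTheory.Balaban1983to89.B6SectAUnitsHomogeneityV1

open LatticeFieldCalculus B6SectADomainsV1
open B6SectAOperatorsV1 (onE gradFn divFn curlFn diagFn ScalarSpace BondIdx dE dsE dcE dcsE QE QsE aE RE KE lapE lapE_apply)
open B6SectAVectorModelV1 (deltaAE deltaAE_def GE deltaAE_GE GE_deltaAE)

noncomputable section

variable {P : Params} (D : Domains P)

/-! ## §1  `Δ`, `ΔN(Q′)` and the projection `R` -/

/-- **`Δ(s·c) = s²·Δ(c)`** for the lattice Laplacian `Δ = ∂*∂` of (2.8) (`laplace` carries `c²`). [cite: Balaban1984PropagatorsII, (2.8) p.224 (units bookkeeping)] -/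
theorem lapE_mul (s c : ℝ) : lapE (P := P) (s * c) = (s ^ 2) • lapE c := by
  apply LinearMap.ext; intro f
  apply (WithLp.linearEquiv 2 ℝ (Site P 0 → ℝ)).injective
  funext x
  have h1 := lapE_apply (s * c) f x
  have h2 := lapE_apply c f x
  simp only [LinearMap.smul_apply]
  show WithLp.ofLp (lapE (s * c) f) x = WithLp.ofLp ((s ^ 2) • lapE c f) x
  rw [WithLp.ofLp_smul, Pi.smul_apply, smul_eq_mul]
  change lapE (s * c) f x = s ^ 2 * lapE c f x
  rw [h1, h2]
  simp only [laplace, smul_eq_mul, Finset.mul_sum]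
  refine Finset.sum_congr rfl fun μ _ => ?_
  ring

/-- **`Δ(s·c)N(Q′) = Δ(c)N(Q′)`** (`s ≠ 0`): the subspace of (2.10)–(2.12) does not see the lattice factor. [cite: Balaban1984PropagatorsII, (2.10)–(2.12) p.225 (units bookkeeping)] -/
theorem KE_mul {s : ℝ} (hs : s ≠ 0) (c : ℝ) : KE D (s * c) = KE D c := by
  unfold KE
  rw [lapE_mul, Submodule.map_smul _ _ _ (pow_ne_zero 2 hs)]

/-- orthogonal projections onto equal subspaces are equal (the instance is a `Prop`). [folklore] -/
private theorem starProjection_congr {K₁ K₂ : Submodule ℝ (ScalarSpace P)} (e : K₁ = K₂)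
    [K₁.HasOrthogonalProjection] [K₂.HasOrthogonalProjection] :
    (K₁.starProjection : ScalarSpace P →L[ℝ] ScalarSpace P) = K₂.starProjection := by
  subst e; rfl

/-- **`R(s·c) = R(c)`** (`s ≠ 0`): the orthogonal projection `R` onto `ΔN(Q′)` of (2.12) is homogeneous of degree 0 in the lattice factor.
[cite: Balaban1984PropagatorsII, (2.12) p.225 (units bookkeeping)] -/
theorem RE_mul {s : ℝ} (hs : s ≠ 0) (c : ℝ) : RE D (s * c) = RE D c := by
  have h := KE_mul D hs c
  unfold RE
  rw [starProjection_congr h]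

/-! ## §2  The derivative letters have degree 1; the averaging letter is linear in the weights -/

/-- the `ℓ²` reading of a scaled map of function spaces. [cite: Balaban1984PropagatorsII, (2.8) p.224 (units bookkeeping)] -/
theorem onE_smul {ι κ : Type*} (s : ℝ) (f : (ι → ℝ) →ₗ[ℝ] (κ → ℝ)) : onE (s • f) = s • onE f := by
  unfold onE; rw [LinearMap.smul_comp, LinearMap.comp_smul]

/-- `∂(s·c) = s·∂(c)` on functions. [cite: Balaban1984PropagatorsII, (2.7)–(2.8) p.224 (units bookkeeping)] -/
theorem gradFn_mul (s c : ℝ) : gradFn (P := P) (s * c) = s • gradFn c := by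
  apply LinearMap.ext; intro f; funext b
  show grad (s * c) f b = (s • grad c f) b
  simp only [grad, Pi.smul_apply, smul_eq_mul, mul_assoc]

/-- `∂*(s·c) = s·∂*(c)` on functions. [cite: Balaban1984PropagatorsII, (2.8) p.224 (units bookkeeping)] -/
theorem divFn_mul (s c : ℝ) : divFn (P := P) (s * c) = s • divFn c := by
  apply LinearMap.ext; intro A; funext x
  show diverg (s * c) A x = (s • diverg c A) x
  simp only [diverg, Pi.smul_apply, smul_eq_mul, Finset.mul_sum, mul_assoc]

/-- the plaquette variable scales with degree 1. [cite: Balaban1984PropagatorsII, (2.19) p.226 (units bookkeeping)] -/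
theorem curlFn_mul (s c : ℝ) : curlFn (P := P) (s * c) = s • curlFn c := by
  apply LinearMap.ext; intro A; funext q
  show curl (s * c) A q = (s • curlFn c A) q
  simp only [curl, Pi.smul_apply, smul_eq_mul, mul_assoc]
  rfl

/-- **`∂(s·c) = s·∂(c)`** on `L²`. [cite: Balaban1984PropagatorsII, (2.7)–(2.8) p.224 (units bookkeeping)] -/
theorem dE_mul (s c : ℝ) : dE (P := P) (s * c) = s • dE c := by
  unfold dE; rw [gradFn_mul, onE_smul]

/-- **`∂*(s·c) = s·∂*(c)`** on `L²`. [cite: Balaban1984PropagatorsII, (2.8) p.224 (units bookkeeping)] -/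
theorem dsE_mul (s c : ℝ) : dsE (P := P) (s * c) = s • dsE c := by
  unfold dsE; rw [divFn_mul, onE_smul]

/-- the plaquette variable on `L²` scales with degree 1. [cite: Balaban1984PropagatorsII, (2.19) p.226 (units bookkeeping)] -/
theorem dcE_mul (s c : ℝ) : dcE (P := P) (s * c) = s • dcE c := by
  unfold dcE; rw [curlFn_mul, onE_smul]

/-- its adjoint `∂*` on plaquette fields scales with degree 1 (real scalars: the adjoint is linear). [cite: Balaban1984PropagatorsII, (2.19) p.226 (units bookkeeping)] -/
theorem dcsE_mul (s c : ℝ) : dcsE (P := P) (s * c) = s • dcsE c := by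
  unfold dcsE; rw [dcE_mul, map_smulₛₗ LinearMap.adjoint]; rfl

/-- the averaging letter `a` of (2.19) is linear in the weights. [cite: Balaban1984PropagatorsII, (2.16)–(2.19) pp.225–226 (units bookkeeping)] -/
theorem aE_smul (s : ℝ) (w : BondIdx D → ℝ) : aE D (s • w) = s • aE D w := by
  unfold aE
  have : diagFn (s • w) = s • diagFn w := by
    apply LinearMap.ext; intro v; funext i
    show (s • w) i * v i = (s • diagFn w v) i
    simp only [Pi.smul_apply, smul_eq_mul, mul_assoc]
    rfl
  rw [this, onE_smul]

/-! ## §3  `Δ_a` has degree 2 and `G = Δ_a⁻¹` degree −2 when the weights scale with the square -/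

/-- **`Δ_a(s·c, s²·w) = s²·Δ_a(c, w)`** (`s ≠ 0`) for (2.19) `Δ_a = ∂*∂ + ∂R∂* + Q*aQ`: with `s = L`, the re-indexed member of `Node00.N03IndexOddL`
HONEST SCOPE (2) (`c_f = L·c_f′`, `w = L²·w′`) has `Δ_a ↦ L²·Δ_a`. [cite: Balaban1984PropagatorsII, (2.19) p.226 (units bookkeeping)] -/
theorem deltaAE_mul {s : ℝ} (hs : s ≠ 0) (c : ℝ) (w : BondIdx D → ℝ) :
    deltaAE D (s * c) ((s ^ 2) • w) = (s ^ 2) • deltaAE D c w := by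
  rw [deltaAE_def, deltaAE_def, dcsE_mul, dcE_mul, dE_mul, dsE_mul, RE_mul D hs, aE_smul]
  simp only [LinearMap.smul_comp, LinearMap.comp_smul, smul_smul, smul_add, sq]

/-- **`G(s·c, s²·w) = s⁻²·G(c, w)`** for (2.22) `G = Δ_a⁻¹` (apply `G(s·c, s²·w)` to `u = Δ_a(s·c, s²·w)(s⁻²·G(c, w)u)`): with `s = L` the re-indexed member
has `G ↦ L⁻²·G`, and the band (2.16) is invariant because `w∕(c_f∕Lⁿ)²` is. [cite: Balaban1984PropagatorsII, (2.22) p.226 (units bookkeeping)] -/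
theorem GE_mul {s c : ℝ} (hs : s ≠ 0) (hc : c ≠ 0) {w : BondIdx D → ℝ} (hw : ∀ i, 0 < w i)
    (hsc : s * c ≠ 0) (hsw : ∀ i, 0 < ((s ^ 2) • w) i) :
    GE D hsc hsw = (s ^ 2)⁻¹ • GE D hc hw := by
  apply LinearMap.ext; intro u
  have hs2 : s ^ 2 ≠ 0 := pow_ne_zero 2 hs
  have key : deltaAE D (s * c) ((s ^ 2) • w) ((s ^ 2)⁻¹ • GE D hc hw u) = u := by
    rw [deltaAE_mul D hs, LinearMap.smul_apply, map_smul, smul_smul, mul_inv_cancel₀ hs2, one_smul, deltaAE_GE]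
  calc GE D hsc hsw u = GE D hsc hsw (deltaAE D (s * c) ((s ^ 2) • w) ((s ^ 2)⁻¹ • GE D hc hw u)) := by rw [key]
    _ = (s ^ 2)⁻¹ • GE D hc hw u := GE_deltaAE D hsc hsw _
    _ = ((s ^ 2)⁻¹ • GE D hc hw) u := rfl

/-- the side conditions of `GE_mul` hold for `s ≠ 0`, `c ≠ 0`, `w > 0` (so the scaled member's `G` is defined whenever the original's is).
[cite: Balaban1984PropagatorsII, (2.22) p.226 (units bookkeeping)] -/
theorem GE_mul' {s c : ℝ} (hs : s ≠ 0) (hc : c ≠ 0) {w : BondIdx D → ℝ} (hw : ∀ i, 0 < w i) :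
    GE D (mul_ne_zero hs hc) (w := (s ^ 2) • w)
        (fun i => by simp only [Pi.smul_apply, smul_eq_mul]; exact mul_pos (by positivity) (hw i)) =
      (s ^ 2)⁻¹ • GE D hc hw :=
  GE_mul D hs hc hw _ _

end

end Literature.MathematicalPhysics.QuantumFieldTheory.Balaban1983to89.B6SectAUnitsHomogeneityV1
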